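import Literature.InformationTheory.QuantumCodes.CSSFiniteSizeBoundsAnisotropic
import Literature.InformationTheory.QuantumCodes.CSSPhenomenologicalDepolarizing
import HarnessLib

/-!
# Finite-size failure bounds for ONE CSS code under DEPOLARIZING noise, sector-wise minimum-weight decoding:
# code capacity `P ≤ n r_X^{d^X}/((w_Z-1)(1-r_X)) + n r_Z^{d^Z}/((w_X-1)(1-r_Z))` at flip rate `2p/3`, and the
# three-rate phenomenological law (`T` rounds) — generic census interface for every row with known check weights and distances

Topic `Literature/InformationTheory/QuantumCodes` (venture QEC, LADDER-QEC rung Q5 × Q1; qec-type-09 gen 5, item 09.PHDEPOL). The tree's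
one-sector finite-size bounds (`CSSFiniteSizeBounds.lean`: Dumer–Kovalev–Pryadko Thm 2 with the irreducible-cluster constant `w - 1`;
`CSSFiniteSizeBoundsAnisotropic.lean`: Thm 3 with two rates `p, q ≤ ρ` and the space-time constant `w + 1`) are combined with the
sector-wise union bounds of `DepolarizingCSSDecoding.lean` (code capacity: `P^{depol}(p) ≤ P^X(2p/3) + P^Z(2p/3)`) and
`CSSPhenomenologicalDepolarizing.lean` (three rates: `P ≤ P^{Z,ph}(2p/3, q_X) + P^{X,ph}(2p/3, q_Z)`). PROVED, no named fact; every
KERNEL census row `IsCode n k d` with check weights `≤ w_X, w_Z` instantiates them by `norm_num`: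

* `CSSCode.depolarizingFailureProb_le_of_rowWeight` — i.i.d. depolarizing noise of rate `p` (`s := √((2p/3)(1-2p/3))`), `X`-checks of
  weight `≤ w_X`, `Z`-checks of weight `≤ w_Z` (both `≥ 2`), `d^X, d^Z ≥ 1`, ANY pair of minimum-weight sector decoders:
  `P ≤ n (2(w_Z-1)s)^{d^X} / ((w_Z-1)(1-2(w_Z-1)s)) + n (2(w_X-1)s)^{d^Z} / ((w_X-1)(1-2(w_X-1)s))`.
* `CSSCode.depolPhenomFailureProb_le_of_rowWeight` — the three-rate law, `T` rounds, common rate bound `2p/3, q_X, q_Z ≤ ρ ≤ 1/2`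
  (`s := √(ρ(1-ρ))`), ANY pair of minimum-weight space-time decoders:
  `P ≤ (n+|R_X|)T (2(w_X+1)s)^{d^Z} / ((w_X+1)(1-2(w_X+1)s)) + (n+|R_Z|)T (2(w_Z+1)s)^{d^X} / ((w_Z+1)(1-2(w_Z+1)s))`.

HONEST FRAMING: rigorous UPPER bounds on failure (union bounds) for sector-wise (correlation-blind) minimum-weight decoding; `2p/3` is
the marginal flip rate of the `p/3`-per-Pauli depolarizing convention; not Monte Carlo numbers.

## References

* [DumerKovalevPryadko2015] I. Dumer, A. A. Kovalev, L. P. Pryadko, PRL 115 (2015) 050502, arXiv:1412.6172, Thm 2 (y = 0) with eq.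
  (upper-bound-Nm-CSS), Thm 3 with p. 5 (w → w + 2), eq. (succesful-decoding-depolarizing).
* [AliferisGottesmanPreskill2006] P. Aliferis, D. Gottesman, J. Preskill, arXiv:quant-ph/0504218, §8.2 (chunk p0026 L11: X, Y, Z equiprobable).
-/

noncomputable section

namespace Literature.InformationTheory.QuantumCodes

open Finset Matrix

namespace CSSCode

variable {RX RZ Q : Type*} [Fintype Q] [DecidableEq Q]

/-- **Finite-size code-capacity bound under depolarizing noise, sector-wise minimum-weight decoding** (one CSS code; `X`-checks of
weight `≤ w_X`, `Z`-checks of weight `≤ w_Z`, `w_X, w_Z ≥ 2`; `d^X, d^Z ≥ 1`; `0 ≤ p ≤ 3/4`; `s = √((2p/3)(1-2p/3))` with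
`2(w_X-1)s < 1`, `2(w_Z-1)s < 1`): `P ≤ n(2(w_Z-1)s)^{d^X}/((w_Z-1)(1-2(w_Z-1)s)) + n(2(w_X-1)s)^{d^Z}/((w_X-1)(1-2(w_X-1)s))`.
[cite: DumerKovalevPryadko2015, Thm 2 (y = 0) with eqs. (upper-bound-Nm-CSS), (succesful-decoding-depolarizing)]
[cite: AliferisGottesmanPreskill2006, §8.2 (chunk p0026 L11)] -/
theorem depolarizingFailureProb_le_of_rowWeight [Fintype RX] [Fintype RZ] (C : CSSCode RX RZ Q)
    {DX : Decoder (RZ → ZMod 2) (Q → ZMod 2)} {DZ : Decoder (RX → ZMod 2) (Q → ZMod 2)}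
    (hDX : DX.IsMinWeight C.xSyndrome (C.kerZ : Set (Q → ZMod 2)) hammingNorm)
    (hDZ : DZ.IsMinWeight C.zSyndrome (C.kerX : Set (Q → ZMod 2)) hammingNorm)
    {wX wZ : ℕ} (hwX : 2 ≤ wX) (hwZ : 2 ≤ wZ) (hrowX : ∀ i, (rowSupp C.HX i).card ≤ wX)
    (hrowZ : ∀ i, (rowSupp C.HZ i).card ≤ wZ) (hdX1 : 1 ≤ C.dX) (hdZ1 : 1 ≤ C.dZ)
    {p : ℝ} (hp0 : 0 ≤ p) (hp : p ≤ 3 / 4)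
    (hrX : 2 * ((wX - 1 : ℕ) : ℝ) * Real.sqrt (2 * p / 3 * (1 - 2 * p / 3)) < 1)
    (hrZ : 2 * ((wZ - 1 : ℕ) : ℝ) * Real.sqrt (2 * p / 3 * (1 - 2 * p / 3)) < 1) :
    C.depolarizingFailureProb DX DZ p ≤
      (Fintype.card Q : ℝ) * (2 * ((wZ - 1 : ℕ) : ℝ) * Real.sqrt (2 * p / 3 * (1 - 2 * p / 3))) ^ C.dX /
          (((wZ - 1 : ℕ) : ℝ) * (1 - 2 * ((wZ - 1 : ℕ) : ℝ) * Real.sqrt (2 * p / 3 * (1 - 2 * p / 3)))) +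
        (Fintype.card Q : ℝ) * (2 * ((wX - 1 : ℕ) : ℝ) * Real.sqrt (2 * p / 3 * (1 - 2 * p / 3))) ^ C.dZ /
          (((wX - 1 : ℕ) : ℝ) * (1 - 2 * ((wX - 1 : ℕ) : ℝ) * Real.sqrt (2 * p / 3 * (1 - 2 * p / 3)))) := by
  have hq0 : 0 ≤ 2 * p / 3 := by positivity
  have hq : 2 * p / 3 ≤ 1 / 2 := by linarith
  have h0 := C.depolarizingFailureProb_le DX DZ hp0 (by linarith)
  have hX := C.xFailureProb_le_of_rowWeight hDX hwZ hrowZ hdX1 hq0 hq hrZ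
  have hZ := C.zFailureProb_le_of_rowWeight hDZ hwX hrowX hdZ1 hq0 hq hrX
  linarith

/-- **Finite-size bound under the three-rate phenomenological depolarizing law, sector-wise minimum-weight space-time decoding**
(one CSS code, `T` rounds; `X`-checks of weight `≤ w_X`, `Z`-checks `≤ w_Z`; `d^X, d^Z ≥ 1`; `2p/3, q_X, q_Z ≤ ρ ≤ 1/2`, `s = √(ρ(1-ρ))`,
`2(w_X+1)s < 1`, `2(w_Z+1)s < 1`):
`P ≤ (n+|R_X|)T(2(w_X+1)s)^{d^Z}/((w_X+1)(1-2(w_X+1)s)) + (n+|R_Z|)T(2(w_Z+1)s)^{d^X}/((w_Z+1)(1-2(w_Z+1)s))`.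
[cite: DumerKovalevPryadko2015, Thm 3 with p. 5 (w → w + 2) and eq. (succesful-decoding-depolarizing)]
[cite: AliferisGottesmanPreskill2006, §8.2 (chunk p0026 L11)] -/
theorem depolPhenomFailureProb_le_of_rowWeight [Fintype RX] [DecidableEq RX] [Fintype RZ] [DecidableEq RZ]
    (C : CSSCode RX RZ Q) (T : ℕ)
    {DZ : CSSPhenom.STDecoder RX Q T} {DX : CSSPhenom.STDecoder RZ Q T}
    (hDZ : DZ.IsMinWeight (CSSPhenom.stSyn C.HX T) (CSSPhenom.stCycles C.HX T) hammingNorm)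
    (hDX : DX.IsMinWeight (CSSPhenom.stSyn C.HZ T) (CSSPhenom.stCycles C.HZ T) hammingNorm)
    {wX wZ : ℕ} (hrowX : ∀ i, (rowSupp C.HX i).card ≤ wX) (hrowZ : ∀ i, (rowSupp C.HZ i).card ≤ wZ)
    (hdZ1 : 1 ≤ C.dZ) (hdX1 : 1 ≤ C.dX)
    {p qX qZ ρ : ℝ} (hp0 : 0 ≤ p) (hpρ : 2 * p / 3 ≤ ρ) (hqX0 : 0 ≤ qX) (hqXρ : qX ≤ ρ) (hqZ0 : 0 ≤ qZ)
    (hqZρ : qZ ≤ ρ) (hρ : ρ ≤ 1 / 2) (hrX : 2 * ((wX + 1 : ℕ) : ℝ) * Real.sqrt (ρ * (1 - ρ)) < 1)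
    (hrZ : 2 * ((wZ + 1 : ℕ) : ℝ) * Real.sqrt (ρ * (1 - ρ)) < 1) :
    C.depolPhenomFailureProb T DZ DX p qX qZ ≤
      (((Fintype.card Q + Fintype.card RX) * T : ℕ) : ℝ) *
            (2 * ((wX + 1 : ℕ) : ℝ) * Real.sqrt (ρ * (1 - ρ))) ^ C.dZ /
          (((wX + 1 : ℕ) : ℝ) * (1 - 2 * ((wX + 1 : ℕ) : ℝ) * Real.sqrt (ρ * (1 - ρ)))) +
        (((Fintype.card Q + Fintype.card RZ) * T : ℕ) : ℝ) *
            (2 * ((wZ + 1 : ℕ) : ℝ) * Real.sqrt (ρ * (1 - ρ))) ^ C.dX /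
          (((wZ + 1 : ℕ) : ℝ) * (1 - 2 * ((wZ + 1 : ℕ) : ℝ) * Real.sqrt (ρ * (1 - ρ)))) := by
  have hq0 : 0 ≤ 2 * p / 3 := by positivity
  have h0 := C.depolPhenomFailureProb_le T DZ DX hp0 (by linarith) hqX0 (by linarith) hqZ0 (by linarith)
  have hZ := C.zPhenomFailureProb_le_aniso_of_rowWeight T hDZ hrowX hdZ1 hq0 hqX0 hpρ hqXρ hρ hrX
  have hX := C.xPhenomFailureProb_le_aniso_of_rowWeight T hDX hrowZ hdX1 hq0 hqZ0 hpρ hqZρ hρ hrZ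
  linarith

end CSSCode

end Literature.InformationTheory.QuantumCodes

end
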